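import Literature.InformationTheory.QuantumCodes.CSSFiberDecomposition
import Literature.InformationTheory.QuantumCodes.TwoBlockGACodeEquivalences
import Literature.InformationTheory.QuantumCodes.TwoBlockGASupportGroupBound
import Literature.InformationTheory.QuantumCodes.TwoBlockGADisjointSupports
import Mathlib.GroupTheory.DoubleCoset
import HarnessLib

/-!
# Two-block group-algebra codes over an ARBITRARY finite group decompose along the double cosets
# `G_a x G_b` (Lin–Pryadko 2024 §IV.C), and Statement 7

[LinPryadko2024, §IV.C "Connectivity of 2BGA codes"] (held text arXiv:2306.16400, chunk p0009 L99 – p0010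
L56): for `a, b ∈ F[G]` with support groups `G_a = ⟨supp a⟩`, `G_b = ⟨supp b⟩`, "the row of matrix `H_X`
labeled by the group element `x ∈ G` is in the block associated with the double coset `G_a x G_b` … the
same is true for the `x` th row of matrix `H_Z`. Therefore, if … `G_aG_b ⊊ G`, the code `LP[a,b]` is
decomposed into smaller mutually disconnected subcodes associated with different double cosets in
`G_a\G/G_b`. It is well known that double cosets do not necessarily have the same sizes, so the individual
double-coset subcodes are not expected to be equivalent" … "decomposition of the 2BGA code into a direct sum
of individual double-coset subcodes" … "**Statement 7.** A subcode of a disconnected 2BGA code `LP[a,b]`,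
with some `a,b ∈ F[G]`, supported in the double coset `G_axG_b`, `x ∈ G`, is equivalent to a subcode of
`LP[a,xbx⁻¹]` supported in the double coset `G_a1G_{xbx⁻¹}`" (App. proof, chunk p0018 L54–63: "the
corresponding transformation for a pair of group algebra elements is `[u,v] → [u,vx⁻¹]`; in particular,
the row `x` goes to `1` … this invertible map sends the original double coset `G_axG_b` to
`G_a xG_b x⁻¹ = G_a 1 G_{xbx⁻¹}`").

The tree had the PARAMETER decomposition for ABELIAN groups only, where all blocks are copies of one code over
a subgroup (`TwoBlockCosetDecomposition.lean`, `TwoBlockConnectedComponents.lean`), and, for arbitrary groups,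
the component structure of the Tanner GRAPH (`TwoBlockGATannerGraph.lean`: components ≃ double cosets, no
statement about `k` or `d`); the qec census's non-abelian
cell A.6′ keeps the scope word "connected" precisely because the general blocks differ (CENSUS-PREREG
P3.40, citing §5 p0013 L11–16 "the double-coset subcodes could, potentially, have better parameters than
connected 2BGA codes of equal size"). This file proves the general case on the tree's `TwoBlockGA.css a b`
(`H_X = [L(a)|R(b)]`, `H_Z = [R(b)ᵀ|L(a)ᵀ]`, any finite group, `𝔽₂`), through `CSSFiberDecomposition.lean`:

* `TwoBlockGA.IsInvariantLabelling π a b` — a labelling `π : G → ι` with `π(sx) = π(x)` for `s ∈ supp a`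
  and `π(xt) = π(x)` for `t ∈ supp b`; every such `π` is a block (Tanner) labelling of `LP[a,b]`
  (`IsInvariantLabelling.isTannerLabelling`: row `x` of `H_X` and of `H_Z` only meets qubits `L_y`, `R_y`
  with `π y = π x`), so **`css_k_eq_sum_subcode`** `k(LP[a,b]) = Σ_i k(subcode i)`,
  **`cssMinDist_css_eq_iInf_subcode`** `d = min_i d(subcode i)` (`ℕ∞` convention), the `d^X/d^Z` bounds
  by blocks and the census form `css_isCode_of_subcode`;
* the **double-coset labelling** `dcMk G_a G_b : G → G_a\G/G_b` (Mathlib `DoubleCoset.Quotient`) by any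
  subgroups `G_a ⊇ supp a`, `G_b ⊇ supp b` is invariant (`isInvariantLabelling_dcMk`); with the support
  groups `⟨supp a⟩`, `⟨supp b⟩` (`suppGroup`, the paper's `G_a`, `G_b`) it is the FINEST invariant labelling
  (`IsInvariantLabelling.eq_of_dcMk_eq`); the double-coset subcodes `dcSubcode ha hb D` and
  **`css_k_eq_sum_dcSubcode`**, **`cssMinDist_css_eq_iInf_dcSubcode`**, `css_isCode_of_dcSubcode` — the
  printed decomposition;
* **Statement 7** (`HX_conjRight`, `HZ_conjRight`: `LP[a, xbx⁻¹]` is `LP[a,b]` re-indexed by `z ↦ zx`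
  everywhere; `suppGroup_conj`: `G_{xbx⁻¹} = xG_bx⁻¹`; `dcMk_conj_eq_one_iff`: this re-indexing carries
  the double coset `G_a·1·(xG_bx⁻¹)` onto `G_a x G_b`): **`LinPryadko2024_statement7`** — the subcode of
  `LP[a,b]` on `G_a x G_b` and the subcode of `LP[a, xbx⁻¹]` on `G_a 1 (xG_bx⁻¹)` have the same `d^X`,
  `d^Z`, `k` (and `[[n,k,d]]` predicate / `ℕ∞` distance: `LinPryadko2024_statement7_isCode_iff`,
  `LinPryadko2024_statement7_cssMinDist`); hence **`cssMinDist_css_eq_iInf_conj`**: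
  `d(LP[a,b]) = min_{x ∈ G} d(subcode of LP[a,xbx⁻¹] on its identity double coset)`.

* **Statement 8, disjoint supports, any ambient group** (`mulEquivOne : G_a × G_b ≃ G_a1G_b` for
  `G_a ∩ G_b = {1}`, `prod_HX/HZ_eq_submatrix_dcSubcode_one`): the identity-double-coset subcode of `LP[a,b]`
  IS the code `LP[a|⊗1, 1⊗b|]` over `G_a × G_b` of `TwoBlockGAHypergraphProduct.lean` (an HP code), hence
  **`dcSubcode_one_isCode_of_disjoint`**: `[[2|G_a||G_b|, 2k_ak_b, min(d_a, d_aᵀ, d_b, d_bᵀ)]]` — the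
  whole-group case `|G_a||G_b| = |G|` being `TwoBlockGADisjointSupports.lean`; with Statement 7 every block
  of `LP[a,b]` is such an identity block of some `LP[a, xbx⁻¹]`.

All statements proved; no named facts, no instances: Mathlib's `DoubleCoset.Quotient` carries no `Fintype` /
`DecidableEq` instances, so the double-coset theorems take them as the uniform hypotheses `instDF`, `instDD`
(for all pairs of subgroups at once), discharged classically by the definitions `dcQuotientFintype`,
`dcQuotientDecEq` of this file (e.g. `css_k_eq_sum_dcSubcode (instDF := dcQuotientFintype)
(instDD := dcQuotientDecEq) ha hb`).
Statement 8 in general (`N = G_a ∩ G_b` non-trivial, abelian and normal in both: a new group `G'`) is not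
typed here (`TODO(general form)`); its abelian case is `AbelianTwoBlockQuasiAbelianLP.lean`.

## References (locators read on the page via `lit read arxiv:2306.16400`, held corpus-tex copy)

* [LinPryadko2024] H.-K. Lin, L. P. Pryadko, *Quantum two-block group algebra codes*, Phys. Rev. A 109
  (2024) 022407 = arXiv:2306.16400: §IV.C (chunk p0009 L99–135: `G_a ≡ ⟨{g ∈ G : a_g ≠ 0}⟩`, `L(a)` block
  diagonal on the cosets `G_a x`, `R(b)` on `x G_b`; p0010 L1–13, L34–46; Statement 7 L47–51; the abelian
  remark L53–56); §IV.B Thm 6(ii) (p0009 L80); App. §VIII.A proof of Statement 7 (chunk p0018 L54–63);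
  §V (chunk p0013 L11–16, "we decided to only consider the connected codes").
* [CalderbankEtAl1998] Calderbank–Rains–Shor–Sloane, IEEE Trans. IT 44 (1998) 1369 = arXiv:quant-ph/9608006,
  §4 (chunk p0013 L24–27: direct sum `[[n+n′, k+k′, min{d,d′}]]`).
-/

namespace Literature.InformationTheory.QuantumCodes

open Matrix

namespace TwoBlockGA

variable {G : Type*} [Group G] {R : Type*} {ι : Type*}

/-! ### Invariant labellings are block labellings of `LP[a,b]` -/

/-- A labelling `π : G → ι` of the group elements that is **invariant** under left multiplication by the
support of `a` and right multiplication by the support of `b` (hence under `G_a` on the left and `G_b` on the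
right): the block structure of [LinPryadko2024, §IV.C]. [cite: LinPryadko2024, §IV.C "repeated left multiplication by a can only generate group algebra elements ax, a²x, …, supported on the left coset G_ax … The same is true for R(b), except in this case we are dealing with the right cosets xG_b" (arXiv:2306.16400 chunk p0009 L122–135)] -/
structure IsInvariantLabelling [Zero R] (π : G → ι) (a b : G → R) : Prop where
  /-- `a_s ≠ 0 ⟹ π(sx) = π(x)` -/
  left : ∀ s x, a s ≠ 0 → π (s * x) = π x
  /-- `b_t ≠ 0 ⟹ π(xt) = π(x)` -/
  right : ∀ t x, b t ≠ 0 → π (x * t) = π x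

/-- **An invariant labelling is a block (Tanner) labelling of `LP[a,b]`** (checks labelled by `π`, both
qubit blocks labelled by `π`): row `x` of `H_X = [L(a)|R(b)]` has entries `a(xy⁻¹)` at `L_y` and `b(y⁻¹x)`
at `R_y`, row `x` of `H_Z = [R(b)ᵀ|L(a)ᵀ]` has `b(x⁻¹y)` at `L_y` and `a(yx⁻¹)` at `R_y`; a non-zero entry
forces `π y = π x`. [cite: LinPryadko2024, §IV.C "the row of matrix H_X labeled by the group element x ∈ G is in the block associated with the double coset G_a x G_b … the same is true for the x th row of matrix H_Z" (arXiv:2306.16400 chunk p0010 L1–6)] -/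
theorem IsInvariantLabelling.isTannerLabelling [Fintype G] {π : G → ι} {a b : G → ZMod 2}
    (h : IsInvariantLabelling π a b) : (css a b).IsTannerLabelling π π (Sum.elim π π) where
  labelX := by
    rintro x (y | y) hne
    · rw [css_HX, HX_apply_inl] at hne
      have := h.left _ y hne
      rwa [inv_mul_cancel_right] at this
    · rw [css_HX, HX_apply_inr] at hne
      have := h.right _ y hne
      rwa [mul_inv_cancel_left] at this
  labelZ := by
    rintro x (y | y) hne
    · rw [css_HZ, HZ_apply_inl] at hne
      have := h.right _ x hne
      rw [mul_inv_cancel_left] at this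
      exact this.symm
    · rw [css_HZ, HZ_apply_inr] at hne
      have := h.left _ x hne
      rw [inv_mul_cancel_right] at this
      exact this.symm

/-- The **subcode of `LP[a,b]` on the block labelled `i`** (checks `x` and qubits `L_y`, `R_y` with label `i`,
check matrices restricted): the fibre code of `CSSFiberDecomposition.lean`.
[cite: LinPryadko2024, §IV.C "the code LP[a,b] is decomposed into smaller mutually disconnected subcodes" (arXiv:2306.16400 chunk p0010 L6–10)] -/
abbrev subcode [Fintype G] [DecidableEq ι] {π : G → ι} {a b : G → ZMod 2} (h : IsInvariantLabelling π a b)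
    (i : ι) : CSSCode {x // π x = i} {x // π x = i} {q // Sum.elim π π q = i} :=
  (css a b).fiberCode h.isTannerLabelling i

section Blocks

variable [Fintype G] [Fintype ι] [DecidableEq ι] {π : G → ι} {a b : G → ZMod 2}

/-- **`k(LP[a,b]) = Σ_i k(subcode i)`** for every invariant labelling.
[cite: LinPryadko2024, §IV.C "decomposition of the 2BGA code into a direct sum of individual double-coset subcodes" (arXiv:2306.16400 chunk p0010 L34–36)] -/
theorem css_k_eq_sum_subcode (h : IsInvariantLabelling π a b) : (css a b).k = ∑ i, (subcode h i).k :=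
  (css a b).k_eq_sum_fiberCode h.isTannerLabelling

/-- **`d(LP[a,b]) = min_i d(subcode i)`** (`ℕ∞` convention: blocks without logicals count `⊤`).
[cite: LinPryadko2024, §IV.C (arXiv:2306.16400 chunk p0010 L6–13, L34–36)] [cite: CalderbankEtAl1998, §4 "d″ = min{d, d′}" (arXiv:quant-ph/9608006 chunk p0013 L26)] -/
theorem cssMinDist_css_eq_iInf_subcode (h : IsInvariantLabelling π a b) :
    cssMinDist (css a b).HX (css a b).HZ = ⨅ i, cssMinDist (subcode h i).HX (subcode h i).HZ :=
  (css a b).cssMinDist_eq_iInf_fiberCode h.isTannerLabelling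

/-- `d^Z(LP[a,b]) ≤ d^Z(subcode i)` for every block with a `Z`-logical.
[cite: LinPryadko2024, §IV.C (arXiv:2306.16400 chunk p0010 L6–13)] -/
theorem css_dZ_le_subcode_dZ (h : IsInvariantLabelling π a b) (i : ι)
    (hex : ∃ u, (subcode h i).HX *ᵥ u = 0 ∧ u ∉ (subcode h i).rowSpZ) : (css a b).dZ ≤ (subcode h i).dZ :=
  (css a b).dZ_le_fiberCode_dZ h.isTannerLabelling i hex

/-- `d^X(LP[a,b]) ≤ d^X(subcode i)` for every block with an `X`-logical.
[cite: LinPryadko2024, §IV.C (arXiv:2306.16400 chunk p0010 L6–13)] -/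
theorem css_dX_le_subcode_dX (h : IsInvariantLabelling π a b) (i : ι)
    (hex : ∃ u, (subcode h i).HZ *ᵥ u = 0 ∧ u ∉ (subcode h i).rowSpX) : (css a b).dX ≤ (subcode h i).dX :=
  (css a b).dX_le_fiberCode_dX h.isTannerLabelling i hex

/-- Lower bound on `d^Z(LP[a,b])` from blockwise lower bounds. [cite: LinPryadko2024, §IV.C (arXiv:2306.16400 chunk p0010 L6–13)] -/
theorem le_css_dZ_of_subcode (h : IsInvariantLabelling π a b) {d : ℕ}
    (hex : ∃ i, ∃ u, (subcode h i).HX *ᵥ u = 0 ∧ u ∉ (subcode h i).rowSpZ)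
    (hd : ∀ i u, (subcode h i).HX *ᵥ u = 0 → u ∉ (subcode h i).rowSpZ → d ≤ hammingNorm u) : d ≤ (css a b).dZ :=
  (css a b).le_dZ_of_fiberCode h.isTannerLabelling hex hd

/-- Lower bound on `d^X(LP[a,b])` from blockwise lower bounds. [cite: LinPryadko2024, §IV.C (arXiv:2306.16400 chunk p0010 L6–13)] -/
theorem le_css_dX_of_subcode (h : IsInvariantLabelling π a b) {d : ℕ}
    (hex : ∃ i, ∃ u, (subcode h i).HZ *ᵥ u = 0 ∧ u ∉ (subcode h i).rowSpX)
    (hd : ∀ i u, (subcode h i).HZ *ᵥ u = 0 → u ∉ (subcode h i).rowSpX → d ≤ hammingNorm u) : d ≤ (css a b).dX :=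
  (css a b).le_dX_of_fiberCode h.isTannerLabelling hex hd

/-- **Census form**: blocks `[[nᵢ, kᵢ, dᵢ]]` (`kᵢ > 0`) assemble to `LP[a,b] = [[Σ nᵢ, Σ kᵢ, minᵢ dᵢ]]`.
[cite: LinPryadko2024, §IV.C (arXiv:2306.16400 chunk p0010 L34–36)] [cite: CalderbankEtAl1998, §4 (arXiv:quant-ph/9608006 chunk p0013 L24–27)] -/
theorem css_isCode_of_subcode [DecidableEq G] (h : IsInvariantLabelling π a b) {n k d : ι → ℕ}
    (hc : ∀ i, (subcode h i).IsCode (n i) (k i) (d i)) (i₀ : ι) (hd : ∀ i, d i₀ ≤ d i) :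
    (css a b).IsCode (∑ i, n i) (∑ i, k i) (d i₀) :=
  (css a b).isCode_of_fiberCode h.isTannerLabelling hc i₀ hd

end Blocks

/-! ### The double-coset labelling `x ↦ G_a x G_b` -/

/-- The **double-coset label** `x ↦ G_a x G_b ∈ G_a\G/G_b` for a pair of subgroups (Mathlib `DoubleCoset.Quotient`);
[LinPryadko2024] take `G_a = ⟨supp a⟩`, `G_b = ⟨supp b⟩` (`suppGroup`); any subgroups containing the supports work.
[cite: LinPryadko2024, §IV.C "the block associated with the double coset G_a x G_b" (arXiv:2306.16400 chunk p0010 L1–3)] -/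
abbrev dcMk (Ha Hb : Subgroup G) (x : G) : DoubleCoset.Quotient (Ha : Set G) Hb := DoubleCoset.mk Ha Hb x

/-- `dcMk G_a G_b x = dcMk G_a G_b y ↔ y ∈ G_a x G_b`. [cite: LinPryadko2024, §IV.C (arXiv:2306.16400 chunk p0010 L1–3)] -/
theorem dcMk_eq_iff (Ha Hb : Subgroup G) (x y : G) :
    dcMk Ha Hb x = dcMk Ha Hb y ↔ ∃ g ∈ Ha, ∃ k ∈ Hb, y = g * x * k :=
  DoubleCoset.eq _ _ x y

/-- **The double-coset labelling is invariant** as soon as `supp a ⊆ G_a` and `supp b ⊆ G_b`.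
[cite: LinPryadko2024, §IV.C (arXiv:2306.16400 chunk p0009 L122–135, p0010 L1–3)] -/
theorem isInvariantLabelling_dcMk [Zero R] {Ha Hb : Subgroup G} {a b : G → R} (ha : ∀ g, a g ≠ 0 → g ∈ Ha)
    (hb : ∀ g, b g ≠ 0 → g ∈ Hb) : IsInvariantLabelling (dcMk Ha Hb) a b where
  left s x hs := by
    rw [dcMk_eq_iff]
    exact ⟨s⁻¹, Ha.inv_mem (ha s hs), 1, Hb.one_mem, by group⟩
  right t x ht := by
    rw [dcMk_eq_iff]
    exact ⟨1, Ha.one_mem, t⁻¹, Hb.inv_mem (hb t ht), by group⟩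

/-- The support groups qualify: `x ↦ G_a x G_b` with `G_a = ⟨supp a⟩`, `G_b = ⟨supp b⟩` is an invariant labelling.
[cite: LinPryadko2024, §IV.C "G_a ≡ ⟨{g ∈ G : a_g ≠ 0}⟩" (arXiv:2306.16400 chunk p0009 L116–121)] -/
theorem isInvariantLabelling_dcMk_suppGroup [Zero R] (a b : G → R) :
    IsInvariantLabelling (dcMk (suppGroup a) (suppGroup b)) a b :=
  isInvariantLabelling_dcMk (fun _ h => mem_suppGroup_of_ne_zero h) (fun _ h => mem_suppGroup_of_ne_zero h)

/-- **The labelling by `⟨supp a⟩ x ⟨supp b⟩` is the finest invariant labelling**: an invariant labelling is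
constant on every double coset `G_a x G_b` of the support groups (invariance under `supp a` propagates to the
generated subgroup). [cite: LinPryadko2024, §IV.C "G_a ≡ ⟨{g ∈ G : a_g ≠ 0}⟩, the support group generated by group elements with non-zero coefficients in a" (arXiv:2306.16400 chunk p0009 L116–121)] -/
theorem IsInvariantLabelling.eq_of_dcMk_eq [Zero R] {π : G → ι} {a b : G → R} (h : IsInvariantLabelling π a b)
    {x y : G} (hxy : dcMk (suppGroup a) (suppGroup b) x = dcMk (suppGroup a) (suppGroup b) y) : π x = π y := by
  obtain ⟨g, hg, k, hk, rfl⟩ := (dcMk_eq_iff _ _ x y).1 hxy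
  -- invariance under the generated subgroups
  have hleft : ∀ g ∈ suppGroup a, ∀ z, π (g * z) = π z := by
    intro g hg
    refine Subgroup.closure_induction (p := fun g _ => ∀ z, π (g * z) = π z) (fun s hs z => h.left s z hs)
      (fun z => by rw [one_mul]) (fun g₁ g₂ _ _ h₁ h₂ z => by rw [mul_assoc, h₁, h₂]) (fun g' _ h' z => ?_) hg
    have := h' (g'⁻¹ * z)
    rw [mul_inv_cancel_left] at this
    exact this.symm
  have hright : ∀ k ∈ suppGroup b, ∀ z, π (z * k) = π z := by
    intro k hk
    refine Subgroup.closure_induction (p := fun k _ => ∀ z, π (z * k) = π z) (fun t ht z => h.right t z ht)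
      (fun z => by rw [mul_one]) (fun k₁ k₂ _ _ h₁ h₂ z => by rw [← mul_assoc, h₂, h₁]) (fun k' _ h' z => ?_) hk
    have := h' (z * k'⁻¹)
    rw [inv_mul_cancel_right] at this
    exact this.symm
  rw [hright k hk, hleft g hg]

/-- The double-coset space `H\\G/K` of a finite group is finite (Mathlib's `DoubleCoset.Quotient` is a
type synonym without instances; this is the classical `Fintype` structure to feed the `instDF` hypotheses
below — a definition, not an instance). [cite: LinPryadko2024, §IV.C "different double cosets in G_a\\\\G/G_b" (arXiv:2306.16400 chunk p0010 L8–10)] -/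
@[reducible] noncomputable def dcQuotientFintype [Finite G] (H K : Subgroup G) : Fintype (DoubleCoset.Quotient (H : Set G) K) := by
  unfold DoubleCoset.Quotient
  exact Fintype.ofFinite _

/-- Classical decidable equality of double cosets (to feed the `instDD` hypotheses below; a definition, not
an instance). [cite: LinPryadko2024, §IV.C (arXiv:2306.16400 chunk p0010 L8–10)] -/
@[reducible] noncomputable def dcQuotientDecEq (H K : Subgroup G) : DecidableEq (DoubleCoset.Quotient (H : Set G) K) :=
  Classical.decEq _

section DoubleCosets

variable [Fintype G] [instDD : ∀ H K : Subgroup G, DecidableEq (DoubleCoset.Quotient (H : Set G) K)]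
  {Ha Hb : Subgroup G} {a b : G → ZMod 2} (ha : ∀ g, a g ≠ 0 → g ∈ Ha) (hb : ∀ g, b g ≠ 0 → g ∈ Hb)

/-- The **double-coset subcode** of `LP[a,b]` on `D = G_a x G_b`: checks `x ∈ D`, qubits `L_y`, `R_y` (`y ∈ D`)
(`supp a ⊆ G_a`, `supp b ⊆ G_b`). [cite: LinPryadko2024, §IV.C "subcodes associated with different double cosets in G_a\\G/G_b" (arXiv:2306.16400 chunk p0010 L6–10)] -/
abbrev dcSubcode (D : DoubleCoset.Quotient (Ha : Set G) Hb) :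
    CSSCode {x // dcMk Ha Hb x = D} {x // dcMk Ha Hb x = D} {q // Sum.elim (dcMk Ha Hb) (dcMk Ha Hb) q = D} :=
  subcode (isInvariantLabelling_dcMk ha hb) D

/-- **`k(LP[a,b]) = Σ_{D ∈ G_a\G/G_b} k(subcode on D)`** — the printed direct-sum decomposition, any finite group.
[cite: LinPryadko2024, §IV.C "decomposition of the 2BGA code into a direct sum of individual double-coset subcodes" (arXiv:2306.16400 chunk p0010 L34–36)] -/
theorem css_k_eq_sum_dcSubcode [instDF : ∀ H K : Subgroup G, Fintype (DoubleCoset.Quotient (H : Set G) K)] :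
    (css a b).k = ∑ D, (dcSubcode ha hb D).k :=
  css_k_eq_sum_subcode (isInvariantLabelling_dcMk ha hb)

/-- **`d(LP[a,b]) = min_{D ∈ G_a\G/G_b} d(subcode on D)`** (`ℕ∞` convention).
[cite: LinPryadko2024, §IV.C (arXiv:2306.16400 chunk p0010 L6–13, L34–36)] [cite: CalderbankEtAl1998, §4 "d″ = min{d, d′}" (arXiv:quant-ph/9608006 chunk p0013 L26)] -/
theorem cssMinDist_css_eq_iInf_dcSubcode [instDF : ∀ H K : Subgroup G, Fintype (DoubleCoset.Quotient (H : Set G) K)] :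
    cssMinDist (css a b).HX (css a b).HZ = ⨅ D, cssMinDist (dcSubcode ha hb D).HX (dcSubcode ha hb D).HZ :=
  cssMinDist_css_eq_iInf_subcode (isInvariantLabelling_dcMk ha hb)

/-- Census form of the double-coset decomposition: `LP[a,b] = [[Σ_D n_D, Σ_D k_D, min_D d_D]]` when every
double-coset subcode is `[[n_D, k_D, d_D]]`. [cite: LinPryadko2024, §IV.C (arXiv:2306.16400 chunk p0010 L34–36)] -/
theorem css_isCode_of_dcSubcode [instDF : ∀ H K : Subgroup G, Fintype (DoubleCoset.Quotient (H : Set G) K)] [DecidableEq G]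
    {n k d : DoubleCoset.Quotient (Ha : Set G) Hb → ℕ} (hc : ∀ D, (dcSubcode ha hb D).IsCode (n D) (k D) (d D))
    (D₀ : DoubleCoset.Quotient (Ha : Set G) Hb) (hd : ∀ D, d D₀ ≤ d D) :
    (css a b).IsCode (∑ D, n D) (∑ D, k D) (d D₀) :=
  css_isCode_of_subcode (isInvariantLabelling_dcMk ha hb) hc D₀ hd

end DoubleCosets

/-! ### Statement 7: the subcode on `G_a x G_b` is the subcode of `LP[a, xbx⁻¹]` on `G_a 1 G_{xbx⁻¹}` -/

/-- `H_X(a, xbx⁻¹)` is `H_X(a,b)` re-indexed by right multiplication by `x` on checks and on both qubit blocks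
(`conj x⁻¹ b = (g ↦ b(x⁻¹gx))` is the coefficient vector of `xbx⁻¹`; the map `[u,v] → [u,vx⁻¹]` of the printed
proof, composed with Thm 6(ii)). [cite: LinPryadko2024, App. proof of Statement 7 "the corresponding transformation for a pair of group algebra elements is [u,v] → [u,vx⁻¹]; in particular, the row x goes to 1" (arXiv:2306.16400 chunk p0018 L56–61)] -/
theorem HX_conjRight (a b : G → ZMod 2) (x : G) :
    HX a (conj x⁻¹ b) = (HX a b).submatrix (Equiv.mulRight x) (Equiv.sumCongr (Equiv.mulRight x) (Equiv.mulRight x)) := by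
  ext r (y | y)
  · simp only [HX_apply_inl, submatrix_apply, Equiv.sumCongr_apply, Sum.map_inl, Equiv.coe_mulRight]
    congr 1; group
  · simp only [HX_apply_inr, conj_apply, submatrix_apply, Equiv.sumCongr_apply, Sum.map_inr, Equiv.coe_mulRight]
    congr 1; group

/-- `H_Z(a, xbx⁻¹)` likewise. [cite: LinPryadko2024, App. proof of Statement 7 (arXiv:2306.16400 chunk p0018 L56–61)] -/
theorem HZ_conjRight (a b : G → ZMod 2) (x : G) :
    HZ a (conj x⁻¹ b) = (HZ a b).submatrix (Equiv.mulRight x) (Equiv.sumCongr (Equiv.mulRight x) (Equiv.mulRight x)) := by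
  ext r (y | y)
  · simp only [HZ_apply_inl, conj_apply, submatrix_apply, Equiv.sumCongr_apply, Sum.map_inl, Equiv.coe_mulRight]
    congr 1; group
  · simp only [HZ_apply_inr, submatrix_apply, Equiv.sumCongr_apply, Sum.map_inr, Equiv.coe_mulRight]
    congr 1; group

/-- The conjugate subgroup `xG_bx⁻¹` (as `Subgroup.map` of the inner automorphism); membership:
`g ∈ xG_bx⁻¹ ↔ x⁻¹gx ∈ G_b`. [cite: LinPryadko2024, §IV.C "G_axG_b = G_a1G_{xbx⁻¹}" (arXiv:2306.16400 chunk p0010 L41–44)] -/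
theorem mem_map_conj_iff (Hb : Subgroup G) (x g : G) :
    g ∈ Hb.map (MulAut.conj x : G ≃* G).toMonoidHom ↔ x⁻¹ * g * x ∈ Hb := by
  rw [Subgroup.mem_map_equiv, MulAut.conj_symm_apply]

/-- If `supp b ⊆ G_b` then `supp (xbx⁻¹) ⊆ xG_bx⁻¹`. [cite: LinPryadko2024, §IV.C "G_axG_b = G_a1G_{xbx⁻¹}" (arXiv:2306.16400 chunk p0010 L41–44)] -/
theorem supp_conj_subset {Hb : Subgroup G} {b : G → ZMod 2} (hb : ∀ g, b g ≠ 0 → g ∈ Hb) (x : G) :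
    ∀ g, conj x⁻¹ b g ≠ 0 → g ∈ Hb.map (MulAut.conj x : G ≃* G).toMonoidHom := by
  intro g hg
  rw [mem_map_conj_iff]
  rw [conj_apply, inv_inv] at hg
  exact hb _ hg

/-- **`G_{β⁻¹bβ} = β⁻¹G_bβ`**: the support group of the conjugate `conj β b = (g ↦ b(βgβ⁻¹))` is the
conjugate subgroup (transport of `⟨supp⟩` along the inner automorphism). [cite: LinPryadko2024, §IV.C "G_axG_b = G_a1G_{xbx⁻¹}" (arXiv:2306.16400 chunk p0010 L41–44)] -/
theorem suppGroup_conj (β : G) (b : G → ZMod 2) :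
    suppGroup (conj β b) = (suppGroup b).map (MulAut.conj β⁻¹ : G ≃* G).toMonoidHom := by
  rw [suppGroup, suppGroup, MonoidHom.map_closure]
  congr 1
  ext g
  simp only [ne_eq, Set.mem_setOf_eq, Set.mem_image, MulEquiv.coe_toMonoidHom, MulAut.conj_apply, inv_inv,
    conj_apply]
  constructor
  · intro hg
    exact ⟨β * g * β⁻¹, hg, by group⟩
  · rintro ⟨g', hg', rfl⟩
    have : β * (β⁻¹ * g' * β) * β⁻¹ = g' := by group
    rwa [this]

/-- `G_{xbx⁻¹} = xG_bx⁻¹` in the orientation used below. [cite: LinPryadko2024, §IV.C "G_axG_b = G_a1G_{xbx⁻¹}" (arXiv:2306.16400 chunk p0010 L41–44)] -/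
theorem suppGroup_conj_inv (x : G) (b : G → ZMod 2) :
    suppGroup (conj x⁻¹ b) = (suppGroup b).map (MulAut.conj x : G ≃* G).toMonoidHom := by
  rw [suppGroup_conj, inv_inv]

/-- **The re-indexing `z ↦ zx` carries the double coset `G_a·1·(xG_bx⁻¹)` onto the double coset `G_a x G_b`**:
`r ∈ G_a 1 (xG_bx⁻¹) ↔ rx ∈ G_a x G_b`.
[cite: LinPryadko2024, App. proof of Statement 7 "this invertible map sends the original double coset G_axG_b to G_a xG_b x⁻¹ = G_a 1 G_{xbx⁻¹}" (arXiv:2306.16400 chunk p0018 L61–63)] -/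
theorem dcMk_conj_eq_one_iff (Ha Hb : Subgroup G) (x r : G) :
    dcMk Ha (Hb.map (MulAut.conj x : G ≃* G).toMonoidHom) r = dcMk Ha (Hb.map (MulAut.conj x : G ≃* G).toMonoidHom) 1 ↔
      dcMk Ha Hb (r * x) = dcMk Ha Hb x := by
  rw [eq_comm, dcMk_eq_iff, eq_comm, dcMk_eq_iff]
  constructor
  · rintro ⟨g, hg, k', hk', hr⟩
    refine ⟨g, hg, x⁻¹ * k' * x, (mem_map_conj_iff Hb x k').1 hk', ?_⟩
    rw [hr]; group
  · rintro ⟨g, hg, k, hk, hr⟩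
    refine ⟨g, hg, x * k * x⁻¹, ?_, ?_⟩
    · rw [mem_map_conj_iff]
      have : x⁻¹ * (x * k * x⁻¹) * x = k := by group
      rwa [this]
    · have : r = r * x * x⁻¹ := by group
      rw [this, hr]; group

section Statement7

variable [Fintype G] [instDD : ∀ H K : Subgroup G, DecidableEq (DoubleCoset.Quotient (H : Set G) K)]
  {Ha Hb : Subgroup G} {a b : G → ZMod 2} (ha : ∀ g, a g ≠ 0 → g ∈ Ha) (hb : ∀ g, b g ≠ 0 → g ∈ Hb) (x : G)

/-- **Lin–Pryadko 2024 Statement 7** (any finite group, `𝔽₂`; any subgroups `G_a ⊇ supp a`, `G_b ⊇ supp b`):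
the subcode of `LP[a,b]` supported in the double coset `G_a x G_b` and the subcode of `LP[a, xbx⁻¹]` supported in
`G_a 1 (xG_bx⁻¹)` are permutation equivalent — same `d^X`, same `d^Z`, same `k` (qubit/check bijection `z ↦ zx`).
[cite: LinPryadko2024, §IV.C Statement 7 "A subcode of a disconnected 2BGA code LP[a,b], with some a,b ∈ F[G], supported in the double coset G_axG_b, x ∈ G, is equivalent to a subcode of LP[a,xbx⁻¹] supported in the double coset G_a1G_{xbx⁻¹}" (arXiv:2306.16400 chunk p0010 L47–51; proof chunk p0018 L54–63)] -/
theorem LinPryadko2024_statement7 :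
    (dcSubcode ha (supp_conj_subset hb x) (dcMk Ha _ 1)).dX = (dcSubcode ha hb (dcMk Ha Hb x)).dX ∧
    (dcSubcode ha (supp_conj_subset hb x) (dcMk Ha _ 1)).dZ = (dcSubcode ha hb (dcMk Ha Hb x)).dZ ∧
    (dcSubcode ha (supp_conj_subset hb x) (dcMk Ha _ 1)).k = (dcSubcode ha hb (dcMk Ha Hb x)).k :=
  CSSCode.fiberCode_params_eq_of_submatrix (C := css a b) (C' := css a (conj x⁻¹ b))
    (ρX := Equiv.mulRight x) (ρZ := Equiv.mulRight x) (σ := Equiv.sumCongr (Equiv.mulRight x) (Equiv.mulRight x))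
    (isInvariantLabelling_dcMk ha hb).isTannerLabelling
    (isInvariantLabelling_dcMk ha (supp_conj_subset hb x)).isTannerLabelling
    (fun r => dcMk_conj_eq_one_iff Ha Hb x r) (fun r => dcMk_conj_eq_one_iff Ha Hb x r)
    (by rintro (r | r) <;> exact dcMk_conj_eq_one_iff Ha Hb x r)
    (by rw [css_HX, css_HX, HX_conjRight]) (by rw [css_HZ, css_HZ, HZ_conjRight])

/-- Statement 7 for the census predicate: the two subcodes are `[[n,k,d]]` together.
[cite: LinPryadko2024, §IV.C Statement 7 (arXiv:2306.16400 chunk p0010 L47–51)] -/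
theorem LinPryadko2024_statement7_isCode_iff [DecidableEq G] (n k d : ℕ) :
    (dcSubcode ha (supp_conj_subset hb x) (dcMk Ha _ 1)).IsCode n k d ↔ (dcSubcode ha hb (dcMk Ha Hb x)).IsCode n k d :=
  CSSCode.fiberCode_isCode_iff_of_submatrix (C := css a b) (C' := css a (conj x⁻¹ b))
    (ρX := Equiv.mulRight x) (ρZ := Equiv.mulRight x) (σ := Equiv.sumCongr (Equiv.mulRight x) (Equiv.mulRight x))
    (isInvariantLabelling_dcMk ha hb).isTannerLabelling
    (isInvariantLabelling_dcMk ha (supp_conj_subset hb x)).isTannerLabelling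
    (fun r => dcMk_conj_eq_one_iff Ha Hb x r) (fun r => dcMk_conj_eq_one_iff Ha Hb x r)
    (by rintro (r | r) <;> exact dcMk_conj_eq_one_iff Ha Hb x r)
    (by rw [css_HX, css_HX, HX_conjRight]) (by rw [css_HZ, css_HZ, HZ_conjRight]) n k d

/-- The `ℕ∞` distance of the two Statement-7 subcodes agrees as well.
[cite: LinPryadko2024, §IV.C Statement 7 (arXiv:2306.16400 chunk p0010 L47–51)] -/
theorem LinPryadko2024_statement7_cssMinDist :
    cssMinDist (dcSubcode ha (supp_conj_subset hb x) (dcMk Ha _ 1)).HX (dcSubcode ha (supp_conj_subset hb x) (dcMk Ha _ 1)).HZ =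
      cssMinDist (dcSubcode ha hb (dcMk Ha Hb x)).HX (dcSubcode ha hb (dcMk Ha Hb x)).HZ := by
  obtain ⟨hX, hZ, hk⟩ := LinPryadko2024_statement7 ha hb x
  by_cases h0 : (dcSubcode ha hb (dcMk Ha Hb x)).k = 0
  · rw [CSSCode.cssMinDist_eq_top _ h0, CSSCode.cssMinDist_eq_top _ (hk.trans h0)]
  · have hpos : 0 < (dcSubcode ha hb (dcMk Ha Hb x)).k := Nat.pos_of_ne_zero h0
    rw [CSSCode.cssMinDist_eq_min_dX_dZ _ hpos, CSSCode.cssMinDist_eq_min_dX_dZ _ (hk.symm ▸ hpos), hX, hZ]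

end Statement7

section Identity

variable [Fintype G] [instDF : ∀ H K : Subgroup G, Fintype (DoubleCoset.Quotient (H : Set G) K)]
  [instDD : ∀ H K : Subgroup G, DecidableEq (DoubleCoset.Quotient (H : Set G) K)]
  {Ha Hb : Subgroup G} {a b : G → ZMod 2} (ha : ∀ g, a g ≠ 0 → g ∈ Ha) (hb : ∀ g, b g ≠ 0 → g ∈ Hb)

/-- **Every 2BGA code is assembled from identity-double-coset subcodes**: `d(LP[a,b])` is the minimum over
`x ∈ G` of the distance of the subcode of `LP[a, xbx⁻¹]` supported in `G_a·1·(xG_bx⁻¹)` (the decomposition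
along `G_a\G/G_b` followed by Statement 7 on each block; `x` runs over all of `G`, each double coset being met
`|G_axG_b|` times, which is immaterial for a minimum).
[cite: LinPryadko2024, §IV.C "different double cosets are related to each other by conjugation … G_axG_b = G_a1G_{xbx⁻¹}, which allows to map any double coset to a double coset containing the group identity element" and Statement 7 (arXiv:2306.16400 chunk p0010 L40–51)] -/
theorem cssMinDist_css_eq_iInf_conj :
    cssMinDist (css a b).HX (css a b).HZ =
      ⨅ x : G, cssMinDist (dcSubcode ha (supp_conj_subset hb x) (dcMk Ha _ 1)).HX
        (dcSubcode ha (supp_conj_subset hb x) (dcMk Ha _ 1)).HZ := by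
  rw [cssMinDist_css_eq_iInf_dcSubcode ha hb]
  have hsurj : Function.Surjective (dcMk Ha Hb) := Quotient.mk''_surjective
  rw [← hsurj.iInf_comp]
  exact iInf_congr fun x => (LinPryadko2024_statement7_cssMinDist ha hb x).symm

end Identity

/-! ### Statement 8, disjoint supports, ANY ambient group: the identity-double-coset subcode is the
hypergraph-product code `LP[a|_{G_a} ⊗ 1, 1 ⊗ b|_{G_b}]` over `G_a × G_b` -/

section IdentityBlock

variable (Ha Hb : Subgroup G)

/-- `(α, β) ↦ αβ` maps `G_a × G_b` into the identity double coset `G_a 1 G_b` (definition).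
[cite: LinPryadko2024, App. proof of Statement 8 "any element of the double coset G_a 1 G_b can be written as a triplet (α,γ,β)" (arXiv:2306.16400 chunk p0018 L79–83)] -/
def mulMapOne (p : Ha × Hb) : {x // dcMk Ha Hb x = dcMk Ha Hb 1} :=
  ⟨(p.1 : G) * p.2, by
    rw [eq_comm, dcMk_eq_iff]
    exact ⟨p.1, p.1.2, p.2, p.2.2, by rw [mul_one]⟩⟩

/-- `mulMapOne (α, β) = αβ`. [cite: LinPryadko2024, App. proof of Statement 8 (arXiv:2306.16400 chunk p0018 L79–83)] -/
@[simp] theorem coe_mulMapOne (p : Ha × Hb) : (mulMapOne Ha Hb p : G) = (p.1 : G) * p.2 := rfl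

/-- For `G_a ∩ G_b = {1}` the map `(α, β) ↦ αβ : G_a × G_b → G_a 1 G_b` is a bijection (injective by the trivial
intersection — `TwoBlockGADisjointSupports.mulMap_injective` —, onto by the definition of the double coset).
[cite: LinPryadko2024, §IV.C "with disjoint subgroups, G_a ∩ G_b = {1}, the group in Statement 8 is just a direct product of the two subgroups, G' = G_a × G_b" (arXiv:2306.16400 chunk p0010 L64–67)] -/
theorem mulMapOne_bijective (hdis : Disjoint Ha Hb) : Function.Bijective (mulMapOne Ha Hb) := by
  constructor
  · intro p q h
    exact mulMap_injective Ha Hb hdis (congrArg Subtype.val h)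
  · rintro ⟨y, hy⟩
    obtain ⟨g, hg, k, hk, rfl⟩ := (dcMk_eq_iff Ha Hb 1 y).1 hy.symm
    exact ⟨(⟨g, hg⟩, ⟨k, hk⟩), Subtype.ext (by simp)⟩

/-- The bijection `G_a × G_b ≃ G_a 1 G_b` for `G_a ∩ G_b = {1}` (definition).
[cite: LinPryadko2024, §IV.C (arXiv:2306.16400 chunk p0010 L64–67)] -/
noncomputable def mulEquivOne (hdis : Disjoint Ha Hb) : Ha × Hb ≃ {x // dcMk Ha Hb x = dcMk Ha Hb 1} :=
  Equiv.ofBijective _ (mulMapOne_bijective Ha Hb hdis)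

/-- `mulEquivOne (α, β) = αβ`. [cite: LinPryadko2024, §IV.C (arXiv:2306.16400 chunk p0010 L64–67)] -/
@[simp] theorem coe_mulEquivOne (hdis : Disjoint Ha Hb) (p : Ha × Hb) :
    (mulEquivOne Ha Hb hdis p : G) = (p.1 : G) * p.2 := rfl

/-- The induced map on qubits: both blocks `L`, `R` of `G_a × G_b` to the qubits of the identity double coset
(definition). [cite: LinPryadko2024, §IV.C "both matrices may simultaneously have the form of Kronecker products, A = A₁ ⊗ I_{n_b}, B = I_{n_a} ⊗ B₁" (arXiv:2306.16400 chunk p0010 L67–72)] -/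
def qubitMapOne (q : (Ha × Hb) ⊕ (Ha × Hb)) :
    {q : G ⊕ G // Sum.elim (dcMk Ha Hb) (dcMk Ha Hb) q = dcMk Ha Hb 1} :=
  Sum.elim (fun p => ⟨Sum.inl (mulMapOne Ha Hb p : G), (mulMapOne Ha Hb p).2⟩)
    (fun p => ⟨Sum.inr (mulMapOne Ha Hb p : G), (mulMapOne Ha Hb p).2⟩) q

/-- `qubitMapOne (L (α,β)) = L (αβ)`. [cite: LinPryadko2024, §IV.C (arXiv:2306.16400 chunk p0010 L67–72)] -/
@[simp] theorem coe_qubitMapOne_inl (p : Ha × Hb) :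
    (qubitMapOne Ha Hb (Sum.inl p) : G ⊕ G) = Sum.inl ((p.1 : G) * p.2) := rfl

/-- `qubitMapOne (R (α,β)) = R (αβ)`. [cite: LinPryadko2024, §IV.C (arXiv:2306.16400 chunk p0010 L67–72)] -/
@[simp] theorem coe_qubitMapOne_inr (p : Ha × Hb) :
    (qubitMapOne Ha Hb (Sum.inr p) : G ⊕ G) = Sum.inr ((p.1 : G) * p.2) := rfl

/-- The qubit map is a bijection for `G_a ∩ G_b = {1}`. [cite: LinPryadko2024, §IV.C (arXiv:2306.16400 chunk p0010 L64–72)] -/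
theorem qubitMapOne_bijective (hdis : Disjoint Ha Hb) : Function.Bijective (qubitMapOne Ha Hb) := by
  have hinj := (mulMapOne_bijective Ha Hb hdis).1
  constructor
  · rintro (p | p) (q | q) h
    · have h' := congrArg Subtype.val h
      simp only [coe_qubitMapOne_inl, Sum.inl.injEq] at h'
      rw [hinj (Subtype.ext h')]
    · exact absurd (congrArg Subtype.val h) (by simp)
    · exact absurd (congrArg Subtype.val h) (by simp)
    · have h' := congrArg Subtype.val h
      simp only [coe_qubitMapOne_inr, Sum.inr.injEq] at h'
      rw [hinj (Subtype.ext h')]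
  · rintro ⟨q, hq⟩
    rcases q with y | y
    · obtain ⟨p, hp⟩ := (mulMapOne_bijective Ha Hb hdis).2 ⟨y, hq⟩
      exact ⟨Sum.inl p, Subtype.ext (by simpa using congrArg Subtype.val hp)⟩
    · obtain ⟨p, hp⟩ := (mulMapOne_bijective Ha Hb hdis).2 ⟨y, hq⟩
      exact ⟨Sum.inr p, Subtype.ext (by simpa using congrArg Subtype.val hp)⟩

/-- The qubit bijection `(G_a × G_b) ⊕ (G_a × G_b) ≃` qubits of the identity double coset (definition).
[cite: LinPryadko2024, §IV.C (arXiv:2306.16400 chunk p0010 L64–72)] -/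
noncomputable def qubitEquivOne (hdis : Disjoint Ha Hb) :
    (Ha × Hb) ⊕ (Ha × Hb) ≃ {q : G ⊕ G // Sum.elim (dcMk Ha Hb) (dcMk Ha Hb) q = dcMk Ha Hb 1} :=
  Equiv.ofBijective _ (qubitMapOne_bijective Ha Hb hdis)

/-- For `α, α' ∈ G_a` and `x ∈ G_b`: `α x α'⁻¹ ∈ G_a ↔ x = 1` (trivial intersection).
[cite: LinPryadko2024, §IV.C "G_a ∩ G_b = {1}" (arXiv:2306.16400 chunk p0010 L64–66)] -/
private theorem conj_mem_iff_one (hdis : Disjoint Ha Hb) (α α' : Ha) {x : G} (hx : x ∈ Hb) :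
    ((α : G) * x * (α' : G)⁻¹ ∈ Ha) ↔ x = 1 := by
  rw [Ha.mul_mem_cancel_right (Ha.inv_mem α'.2), Ha.mul_mem_cancel_left α.2]
  exact ⟨fun h => Subgroup.disjoint_def.mp hdis h hx, fun h => h ▸ Ha.one_mem⟩

/-- … and `β'⁻¹ y β ∈ G_b ↔ y = 1` for `β, β' ∈ G_b`, `y ∈ G_a`. [cite: LinPryadko2024, §IV.C "G_a ∩ G_b = {1}" (arXiv:2306.16400 chunk p0010 L64–66)] -/
private theorem conj_mem_iff_one' (hdis : Disjoint Ha Hb) (β β' : Hb) {y : G} (hy : y ∈ Ha) :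
    ((β' : G)⁻¹ * y * (β : G) ∈ Hb) ↔ y = 1 := by
  rw [Hb.mul_mem_cancel_right β.2, Hb.mul_mem_cancel_left (Hb.inv_mem β'.2)]
  exact ⟨fun h => Subgroup.disjoint_def.mp hdis hy h, fun h => h ▸ Hb.one_mem⟩

variable [Fintype G] [DecidableEq G] [instDD : ∀ H K : Subgroup G, DecidableEq (DoubleCoset.Quotient (H : Set G) K)]
  {Ha Hb} {a b : G → ZMod 2} (ha : ∀ g, a g ≠ 0 → g ∈ Ha) (hb : ∀ g, b g ≠ 0 → g ∈ Hb)
  [DecidablePred (· ∈ Ha)] [DecidablePred (· ∈ Hb)]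

/-- **`H_X` of the identity-double-coset subcode of `LP[a,b]` IS `H_X(LP[a|⊗1, 1⊗b|])` over `G_a × G_b`**
(along `(α,β) ↦ αβ` on checks and both qubit blocks), whenever `G_a ∩ G_b = {1}` — no hypothesis on the
ambient group `G`. [cite: LinPryadko2024, §IV.C Statement 8 and "A = A₁ ⊗ I_{n_b}, B = I_{n_a} ⊗ B₁ … exactly the block structure of an HP code" (arXiv:2306.16400 chunk p0010 L58–74)] -/
theorem prod_HX_eq_submatrix_dcSubcode_one (hdis : Disjoint Ha Hb) :
    (css (prodInl fun α : Ha => a α) (prodInr fun β : Hb => b β)).HX =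
      (dcSubcode ha hb (dcMk Ha Hb 1)).HX.submatrix (mulEquivOne Ha Hb hdis) (qubitEquivOne Ha Hb hdis) := by
  ext ⟨α, β⟩ (⟨α', β'⟩ | ⟨α', β'⟩)
  · -- left block: `a((αβ)(α'β')⁻¹) = [β = β'] · a(αα'⁻¹)`
    simp only [css_HX, HX_apply_inl, submatrix_apply, CSSCode.fiberCode_HX, Prod.snd_mul, Prod.snd_inv,
      Prod.fst_mul, Prod.fst_inv, prodInl_apply, Subgroup.coe_mul, Subgroup.coe_inv, coe_mulEquivOne,
      qubitEquivOne, Equiv.ofBijective_apply, coe_qubitMapOne_inl]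
    have hrw : (α : G) * β * ((α' : G) * β')⁻¹ = α * (β * (β' : G)⁻¹) * (α' : G)⁻¹ := by group
    rw [hrw]
    split_ifs with h
    · have hb' : β = β' := mul_inv_eq_one.mp h
      subst hb'
      rw [mul_inv_cancel, mul_one]
    · symm
      by_contra hne
      refine h ?_
      have h1 := (conj_mem_iff_one Ha Hb hdis α α' (Hb.mul_mem β.2 (Hb.inv_mem β'.2))).mp (ha _ hne)
      exact mul_inv_eq_one.mpr (Subtype.ext (mul_inv_eq_one.mp h1))
  · -- right block: `b((α'β')⁻¹(αβ)) = [α = α'] · b(β'⁻¹β)`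
    simp only [css_HX, HX_apply_inr, submatrix_apply, CSSCode.fiberCode_HX, Prod.snd_mul, Prod.snd_inv,
      Prod.fst_mul, Prod.fst_inv, prodInr_apply, Subgroup.coe_mul, Subgroup.coe_inv, coe_mulEquivOne,
      qubitEquivOne, Equiv.ofBijective_apply, coe_qubitMapOne_inr]
    have hrw : ((α' : G) * β')⁻¹ * ((α : G) * β) = (β' : G)⁻¹ * ((α' : G)⁻¹ * α) * β := by group
    rw [hrw]
    split_ifs with h
    · have ha' : α' = α := inv_mul_eq_one.mp h
      subst ha'
      rw [inv_mul_cancel, mul_one]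
    · symm
      by_contra hne
      refine h ?_
      have h1 := (conj_mem_iff_one' Ha Hb hdis β β' (Ha.mul_mem (Ha.inv_mem α'.2) α.2)).mp (hb _ hne)
      exact inv_mul_eq_one.mpr (Subtype.ext (inv_mul_eq_one.mp h1))

/-- **`H_Z` likewise.** [cite: LinPryadko2024, §IV.C Statement 8 (arXiv:2306.16400 chunk p0010 L58–74)] -/
theorem prod_HZ_eq_submatrix_dcSubcode_one (hdis : Disjoint Ha Hb) :
    (css (prodInl fun α : Ha => a α) (prodInr fun β : Hb => b β)).HZ =
      (dcSubcode ha hb (dcMk Ha Hb 1)).HZ.submatrix (mulEquivOne Ha Hb hdis) (qubitEquivOne Ha Hb hdis) := by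
  ext ⟨α, β⟩ (⟨α', β'⟩ | ⟨α', β'⟩)
  · -- left block of `H_Z`: `b((αβ)⁻¹(α'β')) = [α = α'] · b(β⁻¹β')`
    simp only [css_HZ, HZ_apply_inl, submatrix_apply, CSSCode.fiberCode_HZ, Prod.snd_mul, Prod.snd_inv,
      Prod.fst_mul, Prod.fst_inv, prodInr_apply, Subgroup.coe_mul, Subgroup.coe_inv, coe_mulEquivOne,
      qubitEquivOne, Equiv.ofBijective_apply, coe_qubitMapOne_inl]
    have hrw : ((α : G) * β)⁻¹ * ((α' : G) * β') = (β : G)⁻¹ * ((α : G)⁻¹ * α') * β' := by group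
    rw [hrw]
    split_ifs with h
    · have ha' : α = α' := inv_mul_eq_one.mp h
      subst ha'
      rw [inv_mul_cancel, mul_one]
    · symm
      by_contra hne
      refine h ?_
      have h1 := (conj_mem_iff_one' Ha Hb hdis β' β (Ha.mul_mem (Ha.inv_mem α.2) α'.2)).mp (hb _ hne)
      exact inv_mul_eq_one.mpr (Subtype.ext (inv_mul_eq_one.mp h1))
  · -- right block of `H_Z`: `a((α'β')(αβ)⁻¹) = [β' = β] · a(α'α⁻¹)`
    simp only [css_HZ, HZ_apply_inr, submatrix_apply, CSSCode.fiberCode_HZ, Prod.snd_mul, Prod.snd_inv,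
      Prod.fst_mul, Prod.fst_inv, prodInl_apply, Subgroup.coe_mul, Subgroup.coe_inv, coe_mulEquivOne,
      qubitEquivOne, Equiv.ofBijective_apply, coe_qubitMapOne_inr]
    have hrw : (α' : G) * β' * ((α : G) * β)⁻¹ = α' * (β' * (β : G)⁻¹) * (α : G)⁻¹ := by group
    rw [hrw]
    split_ifs with h
    · have hb' : β' = β := mul_inv_eq_one.mp h
      subst hb'
      rw [mul_inv_cancel, mul_one]
    · symm
      by_contra hne
      refine h ?_
      have h1 := (conj_mem_iff_one Ha Hb hdis α' α (Hb.mul_mem β'.2 (Hb.inv_mem β.2))).mp (ha _ hne)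
      exact mul_inv_eq_one.mpr (Subtype.ext (mul_inv_eq_one.mp h1))

/-- **The identity-double-coset subcode of `LP[a,b]` has the `d^X`, `d^Z`, `k` of `LP[a|⊗1, 1⊗b|]` over
`G_a × G_b`** (`G_a ∩ G_b = {1}`, any ambient group `G`, any subgroups containing the supports).
[cite: LinPryadko2024, §IV.C Statement 8 "the subcode of LP[a,b] supported in the double-coset G_a1G_b is equivalent to a 2BGA code over a group G' … with disjoint subgroups … G' = G_a × G_b" (arXiv:2306.16400 chunk p0010 L58–67)] -/
theorem dcSubcode_one_params_eq_prod (hdis : Disjoint Ha Hb) :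
    (css (prodInl fun α : Ha => a α) (prodInr fun β : Hb => b β)).dX = (dcSubcode ha hb (dcMk Ha Hb 1)).dX ∧
    (css (prodInl fun α : Ha => a α) (prodInr fun β : Hb => b β)).dZ = (dcSubcode ha hb (dcMk Ha Hb 1)).dZ ∧
    (css (prodInl fun α : Ha => a α) (prodInr fun β : Hb => b β)).k = (dcSubcode ha hb (dcMk Ha Hb 1)).k :=
  ⟨CSSCode.dX_eq_of_submatrix (prod_HX_eq_submatrix_dcSubcode_one ha hb hdis) (prod_HZ_eq_submatrix_dcSubcode_one ha hb hdis),
   CSSCode.dZ_eq_of_submatrix (prod_HX_eq_submatrix_dcSubcode_one ha hb hdis) (prod_HZ_eq_submatrix_dcSubcode_one ha hb hdis),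
   CSSCode.k_eq_of_submatrix (prod_HX_eq_submatrix_dcSubcode_one ha hb hdis) (prod_HZ_eq_submatrix_dcSubcode_one ha hb hdis)⟩

/-- ★ **Statement 8 with disjoint supports, any ambient group, corrected distance**: if `supp a ⊆ G_a`,
`supp b ⊆ G_b` with `G_a ∩ G_b = {1}`, the subcode of `LP[a,b]` on the identity double coset `G_a 1 G_b` is a
`[[2|G_a||G_b|, 2 k_a k_b, min(d_a, d_aᵀ, d_b, d_bᵀ)]]` code (`k_a, k_b > 0`), the classical codes being those of
`L_{G_a}(a)`, `R_{G_b}(b)` and their transposes — the whole-group case `G = G_aG_b` is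
`TwoBlockGADisjointSupports.css_isCode_of_disjoint_supports`; the printed `min(d_a, d_b)` is the abelian case
(FINDINGS E-14). By Statement 7 every other block is the identity block of `LP[a, xbx⁻¹]`.
[cite: LinPryadko2024, §IV.C Statement 8 and "[[2n_an_b, 2k_ak_b, min(d_a,d_b)]]_q" (arXiv:2306.16400 chunk p0010 L58–79)] [cite: TillichZemor2014, Thm 9 (arXiv v1 chunk p0008 L11-15)] -/
theorem dcSubcode_one_isCode_of_disjoint (hdis : Disjoint Ha Hb) {ka kb da daT db dbT : ℕ}
    (hka : Module.finrank (ZMod 2) (pcCode (leftMul fun α : Ha => a α)) = ka)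
    (hkb : Module.finrank (ZMod 2) (pcCode (rightMul fun β : Hb => b β)) = kb) (hka0 : 0 < ka) (hkb0 : 0 < kb)
    (hda : Coding.minDist (pcCode (leftMul fun α : Ha => a α)) = da)
    (hdaT : Coding.minDist (pcCode (leftMul fun α : Ha => a α)ᵀ) = daT)
    (hdb : Coding.minDist (pcCode (rightMul fun β : Hb => b β)) = db)
    (hdbT : Coding.minDist (pcCode (rightMul fun β : Hb => b β)ᵀ) = dbT) :
    (dcSubcode ha hb (dcMk Ha Hb 1)).IsCode (2 * Fintype.card Ha * Fintype.card Hb) (2 * ka * kb)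
      (min (min daT dbT) (min da db)) :=
  (CSSCode.isCode_iff_of_submatrix (prod_HX_eq_submatrix_dcSubcode_one ha hb hdis)
      (prod_HZ_eq_submatrix_dcSubcode_one ha hb hdis) _ _ _).mp
    (css_prod_isCode _ _ hka hkb hka0 hkb0 hda hdaT hdb hdbT)

end IdentityBlock

end TwoBlockGA

end Literature.InformationTheory.QuantumCodes
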